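import Summits.MatrixMultiplication.MatrixMultiplication.Theorems.SoloInformedValPairPacking

/-!
# SoloInformedValFanPacking — two fans fill at most two thirds of the group

Solo-informed programme (MatrixMultiplication, side question on the value of trapezoid-free triples), gen 79.

Setting (as in `SoloInformedValInducedMatching`, `SoloInformedValVertexDegree`, `SoloInformedValPairPacking`): an
abelian group `G`, potentials `x : I → G`, `y : J → G`, `z : K → G`, pair graphs `H_IJ, H_JK, H_KI`, and the
hypothesis `NoAccidental`.  A FAN with apex edge `(j, k) ∈ H_JK` is a set `X` of `I`-vertices each adjacent to
`j` in `H_IJ` and to `k` in `H_KI`; it spans `|X|` triangles `(i, j, k)`.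

## Results

* `three_mul_card_add_card_le` — the CHAIN LEMMA (pure additive combinatorics): if `δ : G` and finite sets
  `U, V ⊆ G` satisfy `U ∩ (U + δ) = ∅`, `V ∩ (V + δ) = ∅`, `U ∩ V = ∅` and `(V + δ) ∩ U = ∅`, then
  `3 (|U| + |V|) ≤ 2 |G|`.  (Along every coset of `⟨δ⟩` the pattern is: a point of `U` is followed by a point
  of `V` or by a free point, a point of `V` is followed by a free point; the map "next free point", `t ↦ t + δ`
  or `t + 2δ`, sends `U ∪ V` into the free points at most two-to-one.)
* `NoAccidental.three_mul_card_fans_le` — FAN PAIR PACKING: two fans `X₁` (apex edge `(j₁, k₁)`) and `X₂`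
  (apex edge `(j₂, k₂)`) with `j₁ ≠ j₂` and `k₁ ≠ k₂` satisfy `3 (|X₁| + |X₂|) ≤ 2 |G|` — whether or not the
  fans share `I`-vertices.  With `δ = (y j₂ - z k₂) - (y j₁ - z k₁)` (the difference of the two apex labels),
  `U = x(X₁) + (y j₂ - y j₁)` and `V = x(X₂)`, the four hypotheses of the chain lemma are four instances of
  `NoAccidental` (each would force `j₁ = j₂` or `k₁ = k₂`).
* `fan9_noAccidental`, `fan9_tight` — TIGHTNESS with a shared hub: in `ℤ/9` the fans `{0,1,2} × {0} × {0}` and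
  `{0,7,8} × {1} × {4}` (common `I`-vertex `0`) form a configuration without accidental solutions with
  `3 · (3 + 3) = 18 = 2 · 9`.

So two complete blocks `X_s × Y_s × Z_s` (`s = 1, 2`) with `Y₁ ∩ Y₂ = Z₁ ∩ Z₂ = ∅` inside one accidental-free
configuration always have `|X₁| + |X₂| ≤ 2|G|/3` (take one fan from each), and by the cyclic symmetry of the
setting the same holds for the `J`- and `K`-sides.  For blocks sharing exactly one `I`-vertex ("hub pairs") the
searches of the dossier (15.8)(l) suggest the stronger law `v₁ + v₂ ≤ 2|G|/3` for the VOLUMES; the fan case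
`|Y_s| = |Z_s| = 1` of that law is the present theorem.
-/

namespace Summit.MatrixMultiplication.MatrixMultiplication.Theorems.SoloVal

variable {G : Type*} [AddCommGroup G]

/-- CHAIN LEMMA.  `U ∩ (U + δ) = V ∩ (V + δ) = U ∩ V = (V + δ) ∩ U = ∅` forces `3 (|U| + |V|) ≤ 2 |G|`. -/
theorem three_mul_card_add_card_le [Fintype G] [DecidableEq G] (δ : G) (U V : Finset G)
    (hUU : ∀ u ∈ U, u + δ ∉ U) (hVV : ∀ v ∈ V, v + δ ∉ V) (hUV : Disjoint U V)
    (hVU : ∀ v ∈ V, v + δ ∉ U) : 3 * (U.card + V.card) ≤ 2 * Fintype.card G := by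
  set W : Finset G := U ∪ V with hW
  let φ : G → G := fun t => if t + δ ∈ W then t + δ + δ else t + δ
  -- the "next free point" lies outside `W`
  have hout : ∀ t ∈ W, φ t ∉ W := by
    intro t ht
    by_cases h : t + δ ∈ W
    · have hφ : φ t = t + δ + δ := if_pos h
      rw [hφ]
      rcases Finset.mem_union.mp ht with htU | htV
      · rcases Finset.mem_union.mp h with h' | h'
        · exact absurd h' (hUU t htU)
        · intro hmem
          rcases Finset.mem_union.mp hmem with h2 | h2
          · exact hVU _ h' h2
          · exact hVV _ h' h2
      · rcases Finset.mem_union.mp h with h' | h'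
        · exact absurd h' (hVU t htV)
        · exact absurd h' (hVV t htV)
    · have hφ : φ t = t + δ := if_neg h
      rw [hφ]
      exact h
  -- hence `W.image φ` and `W` are disjoint subsets of `G`
  have hdisj : Disjoint (W.image φ) W := by
    rw [Finset.disjoint_left]
    intro g hg hgW
    obtain ⟨t, ht, rfl⟩ := Finset.mem_image.mp hg
    exact hout t ht hgW
  have hsum : (W.image φ).card + W.card ≤ Fintype.card G := by
    rw [← Finset.card_union_of_disjoint hdisj]
    exact Finset.card_le_univ _
  -- and `φ` is at most two-to-one: `φ t ∈ {t + δ, t + 2δ}`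
  have hfib : ∀ g ∈ W.image φ, (W.filter (fun t => φ t = g)).card ≤ 2 := by
    intro g _
    have hsub : W.filter (fun t => φ t = g) ⊆ {g - δ, g - δ - δ} := by
      intro t ht
      obtain ⟨-, hφ⟩ := Finset.mem_filter.mp ht
      simp only [Finset.mem_insert, Finset.mem_singleton]
      by_cases h : t + δ ∈ W
      · have hφ' : φ t = t + δ + δ := if_pos h
        right
        rw [← hφ, hφ']
        abel
      · have hφ' : φ t = t + δ := if_neg h
        left
        rw [← hφ, hφ']
        abel
    exact (Finset.card_le_card hsub).trans Finset.card_le_two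
  have hW2 : W.card ≤ 2 * (W.image φ).card := Finset.card_le_mul_card_image W 2 hfib
  have hWc : W.card = U.card + V.card := Finset.card_union_of_disjoint hUV
  omega

variable {I J K : Type*}
variable {x : I → G} {y : J → G} {z : K → G}
variable {HIJ : Finset (I × J)} {HJK : Finset (J × K)} {HKI : Finset (K × I)}

/-- FAN PAIR PACKING.  Two fans with distinct `J`-apices and distinct `K`-apices: `3 (|X₁| + |X₂|) ≤ 2 |G|`. -/
theorem NoAccidental.three_mul_card_fans_le [Fintype G] [DecidableEq G]
    (hN : NoAccidental x y z HIJ HJK HKI) {j₁ j₂ : J} {k₁ k₂ : K} (hj : j₁ ≠ j₂) (hk : k₁ ≠ k₂)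
    (he₁ : (j₁, k₁) ∈ HJK) (he₂ : (j₂, k₂) ∈ HJK) {X₁ X₂ : Finset I}
    (h₁ : ∀ i ∈ X₁, (i, j₁) ∈ HIJ ∧ (k₁, i) ∈ HKI) (h₂ : ∀ i ∈ X₂, (i, j₂) ∈ HIJ ∧ (k₂, i) ∈ HKI) :
    3 * (X₁.card + X₂.card) ≤ 2 * Fintype.card G := by
  set δ : G := (y j₂ - z k₂) - (y j₁ - z k₁) with hδ
  set e : G := y j₂ - y j₁ with he
  set U : Finset G := X₁.image (fun i => x i + e) with hU
  set V : Finset G := X₂.image x with hV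
  -- the two parametrisations are injective (a repeated potential inside a fan is an accidental solution)
  have hinj₁ : Set.InjOn (fun i => x i + e) ↑X₁ := by
    intro i hi i' hi' hxe
    have hx : x i = x i' := add_right_cancel hxe
    have hR : (x i - y j₁) + (y j₁ - z k₁) + (z k₁ - x i') = x i - x i' := by abel
    exact (hN i j₁ j₁ k₁ k₁ i' (h₁ i hi).1 he₁ (h₁ i' hi').2 (by rw [hR, hx, sub_self])).1
  have hinj₂ : Set.InjOn x ↑X₂ := by
    intro i hi i' hi' hx
    have hR : (x i - y j₂) + (y j₂ - z k₂) + (z k₂ - x i') = x i - x i' := by abel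
    exact (hN i j₂ j₂ k₂ k₂ i' (h₂ i hi).1 he₂ (h₂ i' hi').2 (by rw [hR, hx, sub_self])).1
  have hcU : U.card = X₁.card := Finset.card_image_of_injOn hinj₁
  have hcV : V.card = X₂.card := Finset.card_image_of_injOn hinj₂
  -- (a) `U ∩ (U + δ) = ∅`
  have hUU : ∀ u ∈ U, u + δ ∉ U := by
    intro u hu hu'
    obtain ⟨i, hi, rfl⟩ := Finset.mem_image.mp hu
    obtain ⟨i', hi', hEq⟩ := Finset.mem_image.mp hu'
    have hR : (x i - y j₁) + (y j₂ - z k₂) + (z k₁ - x i') = (x i + e + δ) - (x i' + e) := by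
      rw [he, hδ]; abel
    exact hj (hN i j₁ j₂ k₂ k₁ i' (h₁ i hi).1 he₂ (h₁ i' hi').2 (by rw [hR, ← hEq, sub_self])).2.1
  -- (b) `V ∩ (V + δ) = ∅`
  have hVV : ∀ v ∈ V, v + δ ∉ V := by
    intro v hv hv'
    obtain ⟨i, hi, rfl⟩ := Finset.mem_image.mp hv
    obtain ⟨i', hi', hEq⟩ := Finset.mem_image.mp hv'
    have hR : (x i' - y j₂) + (y j₁ - z k₁) + (z k₂ - x i) = x i' - (x i + δ) := by
      rw [hδ]; abel
    exact hj (hN i' j₂ j₁ k₁ k₂ i (h₂ i' hi').1 he₁ (h₂ i hi).2 (by rw [hR, hEq, sub_self])).2.1.symm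
  -- (c) `U ∩ V = ∅`
  have hUV : Disjoint U V := by
    rw [Finset.disjoint_left]
    intro g hgU hgV
    obtain ⟨i, hi, rfl⟩ := Finset.mem_image.mp hgU
    obtain ⟨i', hi', hEq⟩ := Finset.mem_image.mp hgV
    have hR : (x i - y j₁) + (y j₂ - z k₂) + (z k₂ - x i') = (x i + e) - x i' := by
      rw [he]; abel
    exact hj (hN i j₁ j₂ k₂ k₂ i' (h₁ i hi).1 he₂ (h₂ i' hi').2 (by rw [hR, ← hEq, sub_self])).2.1
  -- (d) `(V + δ) ∩ U = ∅`
  have hVU : ∀ v ∈ V, v + δ ∉ U := by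
    intro v hv hv'
    obtain ⟨i', hi', rfl⟩ := Finset.mem_image.mp hv
    obtain ⟨i, hi, hEq⟩ := Finset.mem_image.mp hv'
    have hR : (x i - y j₁) + (y j₁ - z k₁) + (z k₂ - x i') = (x i + e) - (x i' + δ) := by
      rw [he, hδ]; abel
    exact hk (hN i j₁ j₁ k₁ k₂ i' (h₁ i hi).1 he₁ (h₂ i' hi').2 (by rw [hR, hEq, sub_self])).2.2
  have := three_mul_card_add_card_le δ U V hUU hVV hUV hVU
  rw [hcU, hcV] at this
  exact this

section Tightness

/-- `I`-potentials `0, 1, 2, 7, 8` in `ℤ/9` (the vertex `0` is the common hub of the two fans). -/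
def fanX : Fin 5 → ZMod 9 := ![0, 1, 2, 7, 8]

/-- `J`-potentials `0, 1`. -/
def fanY : Fin 2 → ZMod 9 := ![0, 1]

/-- `K`-potentials `0, 4`. -/
def fanZ : Fin 2 → ZMod 9 := ![0, 4]

/-- `H_IJ`: fan 1 = `{0,1,2} × {0}`, fan 2 = `{0,3,4} × {1}` (indices). -/
def fanHIJ : Finset (Fin 5 × Fin 2) := {(0, 0), (1, 0), (2, 0), (0, 1), (3, 1), (4, 1)}

/-- `H_JK`: the two apex edges. -/
def fanHJK : Finset (Fin 2 × Fin 2) := {(0, 0), (1, 1)}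

/-- `H_KI`: `{0} × {0,1,2}` and `{1} × {0,3,4}`. -/
def fanHKI : Finset (Fin 2 × Fin 5) := {(0, 0), (0, 1), (0, 2), (1, 0), (1, 3), (1, 4)}

/-- The two hub-sharing fans in `ℤ/9` have no accidental solutions. -/
theorem fan9_noAccidental : NoAccidental fanX fanY fanZ fanHIJ fanHJK fanHKI := by
  unfold NoAccidental fanX fanY fanZ fanHIJ fanHJK fanHKI
  decide

/-- TIGHTNESS of fan pair packing: `3 · (|X₁| + |X₂|) = 3 · (3 + 3) = 18 = 2 · |ℤ/9|`. -/
theorem fan9_tight :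
    3 * (({0, 1, 2} : Finset (Fin 5)).card + ({0, 3, 4} : Finset (Fin 5)).card) = 2 * Fintype.card (ZMod 9) := by
  simp [ZMod.card]

/-- The fans of the example satisfy the hypotheses of `NoAccidental.three_mul_card_fans_le`. -/
theorem fan9_fans :
    (∀ i ∈ ({0, 1, 2} : Finset (Fin 5)), (i, (0 : Fin 2)) ∈ fanHIJ ∧ ((0 : Fin 2), i) ∈ fanHKI) ∧
    (∀ i ∈ ({0, 3, 4} : Finset (Fin 5)), (i, (1 : Fin 2)) ∈ fanHIJ ∧ ((1 : Fin 2), i) ∈ fanHKI) ∧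
    ((0 : Fin 2), (0 : Fin 2)) ∈ fanHJK ∧ ((1 : Fin 2), (1 : Fin 2)) ∈ fanHJK := by
  unfold fanHIJ fanHJK fanHKI
  decide

end Tightness

end Summit.MatrixMultiplication.MatrixMultiplication.Theorems.SoloVal
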